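import Literature.AlgebraicGeometry.ModuliOfAbelianVarieties.SiegelModuliDatum
import Mathlib.Analysis.Calculus.FDeriv.Mul
import Mathlib.Analysis.Calculus.FDeriv.Add
import HarnessLib

/-!
# The `ℂ`-linear avatar of a period-linear real matrix is unique, explicit, and holomorphic in the period matrix
# ([BirkenhakeLange2004] §1.2 Prop. 1.2.1 / §8.1; [Shimura1963AnalyticFamilies] §2)

Layer `Literature/AlgebraicGeometry/ModuliOfAbelianVarieties`, namespace `Literature.AlgebraicGeometry.ModuliOfAbelianVarieties`.  THEOREMS ONLY (no
definition, no named fact, no instance, no notation, no `sorry`).  Cell `hodgecm-mathlib` (D-0151), FLOOR 0, P6 «MOD» (crux hLiu418 =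
stmt-HodgeConjecture-24832, `--supports`), organ **E6-lin** of the E6 road map (`F0/P6/A-p06/g32/ROADMAP-E6.v1`, A-p06 (g32)).  Consumer: the E6
closer of `Cruxes/HLiu418/Lines/F0_P6a_PELWitnessE.lean` — the chart field (F2) `AuxChartGS.Mρ_kottwitz` hands, for every period point `Z a v`, SOME
`ℂ`-linear `Cb` with `Cb ∘ Π_{Z a v} = Π_{Z a v} ∘ (Mρ a b)`; this file shows that such a `Cb` is UNIQUE, computes it on the standard basis, and proves that
along any holomorphic period function `v ↦ Z v` the operator family `v ↦ Cb(v)` is HOLOMORPHIC — the hypothesis `hC` of ★ U6-b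
`IsRelExpChartOn.exists_mdifferentiableOn_comp_ex_eq` (`MarkedFamilyHomCriterion`).  HC_CM is proved only modulo the printed citations until rung 0 closes;
generic, count-neutral.

THE MATHEMATICS.  `Π_Z : ℝ^g ⊕ ℝ^g → ℂ^g`, `(x, y) ↦ Z x + Δ y` (★ `siegelPeriodMap δ Z`, `Δ = diag δ`, `δ_i ≥ 1`) sends the basis vector `e_{μ_i}` of the
second block to `δ_i e_i`, so its image SPANS `ℂ^g` over `ℂ`: a `ℂ`-linear map is determined by its composite with `Π_Z` (uniqueness), and if
`C ∘ Π_Z = Π_Z ∘ M` for a real matrix `M` then `C e_i = δ_i⁻¹ Π_Z (M e_{μ_i})`, i.e. the matrix of `C` is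
`C_{ki} = δ_i⁻¹ (Σ_j Z_{kj} M_{λ_j μ_i} + δ_k M_{μ_k μ_i})` — AFFINE in the entries of `Z`, hence holomorphic along any entrywise-holomorphic `Z(v)`
([BirkenhakeLange2004] §1.2: the analytic representation `ρ_a` of a homomorphism is read off the rational representation `ρ_r` and the period
matrices, «`ρ_a(f) Π = Π′ ρ_r(f)`», (1.2) p. 10).

* §1 `siegelPeriodMap_single_inr` (`Π_Z e_{μ_i} = δ_i e_i`), `eq_of_comp_siegelPeriodMap_eq` (uniqueness), `apply_single_eq_of_comp_siegelPeriodMap`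
  (the explicit matrix entries).
* §2 **`differentiableOn_clm_of_comp_siegelPeriodMap`** — THE HEAD: along `Z : V → M_g(ℂ)` entrywise holomorphic on `s`, any family `C v` of continuous
  `ℂ`-linear maps with `C v ∘ Π_{Z v} = Π_{Z v} ∘ M` (`v ∈ s`) is `DifferentiableOn ℂ` on `s` as a map into `ℂ^g →L[ℂ] ℂ^g`.

## References
* [BirkenhakeLange2004] C. Birkenhake, H. Lange, *Complex Abelian Varieties*, 2nd ed. (2004), §1.2 (analytic and rational representations, (1.2)), §8.1.
* [Shimura1963AnalyticFamilies] G. Shimura, Ann. Math. 78 (1963), §2.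
-/

set_option autoImplicit false

noncomputable section

open Matrix

namespace Literature.AlgebraicGeometry.ModuliOfAbelianVarieties

variable {g : ℕ}

/-! ## §1 The image of the period map spans; uniqueness and the explicit matrix of the avatar -/

/-- `Π_Z (e_{μ_i}) = δ_i · e_i`: the second-block basis vector goes to `δ_i` times the `i`-th standard vector of `ℂ^g`.
[cite: BirkenhakeLange2004, §8.1 (Prop. 8.1.1)] -/
theorem siegelPeriodMap_single_inr (δ : Fin g → ℕ) (Z : Matrix (Fin g) (Fin g) ℂ) (i : Fin g) :
    siegelPeriodMap δ Z (Pi.single (Sum.inr i) 1) = (δ i : ℂ) • Pi.single i (1 : ℂ) := by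
  funext k
  rw [siegelPeriodMap_apply, Pi.smul_apply, smul_eq_mul]
  have h1 : ∀ j : Fin g, (Pi.single (Sum.inr i) (1 : ℝ) : Fin g ⊕ Fin g → ℝ) (Sum.inl j) = 0 :=
    fun j => Pi.single_eq_of_ne (by simp) _
  simp only [h1, Complex.ofReal_zero, mul_zero, Finset.sum_const_zero, zero_add]
  by_cases hk : k = i
  · subst hk
    simp
  · rw [Pi.single_eq_of_ne (by simpa using hk), Pi.single_eq_of_ne hk]
    simp

/-- **Uniqueness of the `ℂ`-linear avatar**: two `ℂ`-linear maps `ℂ^g → W` which agree on the image of `Π_Z` are equal (`δ_i ≥ 1`: the image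
contains `δ_i e_i`). [cite: BirkenhakeLange2004, §1.2 (1.2)] -/
theorem eq_of_comp_siegelPeriodMap_eq {δ : Fin g → ℕ} (hδ : ∀ i, 0 < δ i) (Z : Matrix (Fin g) (Fin g) ℂ) {W : Type*} [AddCommGroup W]
    [Module ℂ W] {C C' : (Fin g → ℂ) →ₗ[ℂ] W} (h : ∀ u : Fin g ⊕ Fin g → ℝ, C (siegelPeriodMap δ Z u) = C' (siegelPeriodMap δ Z u)) :
    C = C' := by
  refine LinearMap.pi_ext' fun i => LinearMap.ext_ring ?_
  have hδi : (δ i : ℂ) ≠ 0 := by exact_mod_cast (hδ i).ne'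
  have hi := h (Pi.single (Sum.inr i) 1)
  rw [siegelPeriodMap_single_inr, map_smul, map_smul] at hi
  have := congrArg (fun w => (δ i : ℂ)⁻¹ • w) hi
  simp only [smul_smul, inv_mul_cancel₀ hδi, one_smul] at this
  simpa using this

/-- **The explicit avatar on the standard basis**: if `C ∘ Π_Z = Π_Z ∘ M` then `C e_i = δ_i⁻¹ · Π_Z (M e_{μ_i})`.
[cite: BirkenhakeLange2004, §1.2 (1.2)] -/
theorem apply_single_eq_of_comp_siegelPeriodMap {δ : Fin g → ℕ} (hδ : ∀ i, 0 < δ i) (Z : Matrix (Fin g) (Fin g) ℂ)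
    (M : Matrix (Fin g ⊕ Fin g) (Fin g ⊕ Fin g) ℝ) {C : (Fin g → ℂ) →ₗ[ℂ] (Fin g → ℂ)}
    (h : ∀ u : Fin g ⊕ Fin g → ℝ, C (siegelPeriodMap δ Z u) = siegelPeriodMap δ Z (M *ᵥ u)) (i : Fin g) :
    C (Pi.single i 1) = (δ i : ℂ)⁻¹ • siegelPeriodMap δ Z (M *ᵥ Pi.single (Sum.inr i) 1) := by
  have hδi : (δ i : ℂ) ≠ 0 := by exact_mod_cast (hδ i).ne'
  have hi := h (Pi.single (Sum.inr i) 1)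
  rw [siegelPeriodMap_single_inr, map_smul] at hi
  rw [← hi, smul_smul, inv_mul_cancel₀ hδi, one_smul]

/-- **The matrix entries of the avatar are affine in `Z`**: `(C e_i)_k = δ_i⁻¹ (Σ_j Z_{kj} M_{λ_j μ_i} + δ_k M_{μ_k μ_i})`.
[cite: BirkenhakeLange2004, §1.2 (1.2)] -/
theorem apply_single_apply_eq_of_comp_siegelPeriodMap {δ : Fin g → ℕ} (hδ : ∀ i, 0 < δ i) (Z : Matrix (Fin g) (Fin g) ℂ)
    (M : Matrix (Fin g ⊕ Fin g) (Fin g ⊕ Fin g) ℝ) {C : (Fin g → ℂ) →ₗ[ℂ] (Fin g → ℂ)}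
    (h : ∀ u : Fin g ⊕ Fin g → ℝ, C (siegelPeriodMap δ Z u) = siegelPeriodMap δ Z (M *ᵥ u)) (i k : Fin g) :
    C (Pi.single i 1) k =
      (δ i : ℂ)⁻¹ * (∑ j, Z k j * (M (Sum.inl j) (Sum.inr i) : ℂ) + (δ k : ℂ) * (M (Sum.inr k) (Sum.inr i) : ℂ)) := by
  rw [apply_single_eq_of_comp_siegelPeriodMap hδ Z M h i, Pi.smul_apply, smul_eq_mul, siegelPeriodMap_apply]
  congr 1
  have hmul : ∀ l : Fin g ⊕ Fin g, (M *ᵥ Pi.single (Sum.inr i) (1 : ℝ)) l = M l (Sum.inr i) := by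
    intro l
    simp [Matrix.mulVec, dotProduct, Pi.single_apply]
  simp only [hmul]

/-! ## §2 Holomorphy of the avatar along a holomorphic period function -/

/-- **THE HEAD — the avatar family is holomorphic.**  Let `V` be a complex normed space, `s ⊆ V`, `Z : V → M_g(ℂ)` with every entry `DifferentiableOn ℂ`
on `s`, `M` a real `2g × 2g` matrix, and `C v : ℂ^g →L[ℂ] ℂ^g` (`v ∈ V`) continuous `ℂ`-linear maps with `C v ∘ Π_{Z v} = Π_{Z v} ∘ M` for `v ∈ s`.  Then
`v ↦ C v` is `DifferentiableOn ℂ` on `s` (operator-valued): `C v = Σ_{k,i} (C v e_i)_k · E_{ki}` with the scalar coefficients affine in the entries of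
`Z v` (§1) and `E_{ki}` the constant elementary operators. [cite: BirkenhakeLange2004, §1.2 (1.2) and §8.1] [cite: Shimura1963AnalyticFamilies, §2] -/
theorem differentiableOn_clm_of_comp_siegelPeriodMap {δ : Fin g → ℕ} (hδ : ∀ i, 0 < δ i) {V : Type*} [NormedAddCommGroup V] [NormedSpace ℂ V]
    {s : Set V} {Z : V → Matrix (Fin g) (Fin g) ℂ} (hZ : ∀ k j, DifferentiableOn ℂ (fun v => Z v k j) s)
    (M : Matrix (Fin g ⊕ Fin g) (Fin g ⊕ Fin g) ℝ) (C : V → ((Fin g → ℂ) →L[ℂ] (Fin g → ℂ)))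
    (h : ∀ v ∈ s, ∀ u : Fin g ⊕ Fin g → ℝ, C v (siegelPeriodMap δ (Z v) u) = siegelPeriodMap δ (Z v) (M *ᵥ u)) :
    DifferentiableOn ℂ C s := by
  -- the scalar coefficient functions
  let a : V → Fin g → Fin g → ℂ := fun v k i =>
    (δ i : ℂ)⁻¹ * (∑ j, Z v k j * (M (Sum.inl j) (Sum.inr i) : ℂ) + (δ k : ℂ) * (M (Sum.inr k) (Sum.inr i) : ℂ))
  have ha : ∀ k i, DifferentiableOn ℂ (fun v => a v k i) s := by
    intro k i
    refine DifferentiableOn.const_mul (DifferentiableOn.add ?_ (differentiableOn_const _)) _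
    refine DifferentiableOn.fun_sum fun j _ => (hZ k j).mul_const _
  -- the elementary operators `E_{ki} x = x_i • e_k`
  let E : Fin g → Fin g → ((Fin g → ℂ) →L[ℂ] (Fin g → ℂ)) := fun k i =>
    (ContinuousLinearMap.proj i : (Fin g → ℂ) →L[ℂ] ℂ).smulRight (Pi.single k (1 : ℂ))
  -- `C v = Σ a v k i • E k i` on `s`
  have hC : ∀ v ∈ s, C v = ∑ k, ∑ i, a v k i • E k i := by
    intro v hv
    have hsingle : ∀ i k, C v (Pi.single i 1) k = a v k i := fun i k =>
      apply_single_apply_eq_of_comp_siegelPeriodMap hδ (Z v) M (C := (C v : (Fin g → ℂ) →ₗ[ℂ] (Fin g → ℂ))) (h v hv) i k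
    ext x l
    -- left: expand `x` in the standard basis
    have hx : C v x = ∑ i, x i • C v (Pi.single i 1) := by
      conv_lhs => rw [← Finset.univ_sum_single x]
      rw [map_sum]
      refine Finset.sum_congr rfl fun i _ => ?_
      rw [← map_smul]
      congr 1
      funext j
      simp [Pi.single_apply]
    rw [hx]
    simp only [Finset.sum_apply, Pi.smul_apply, smul_eq_mul, hsingle, FunLike.coe_sum, Finset.sum_apply,
      FunLike.coe_smul, E, ContinuousLinearMap.smulRight_apply, ContinuousLinearMap.proj_apply]
    rw [Finset.sum_comm]
    refine Finset.sum_congr rfl fun i _ => ?_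
    rw [Finset.sum_eq_single l]
    · simp [mul_comm]
    · intro k _ hk
      simp [Pi.single_eq_of_ne (Ne.symm hk)]
    · intro hl
      exact absurd (Finset.mem_univ l) hl
  -- conclude
  have hsum : DifferentiableOn ℂ (fun v => ∑ k, ∑ i, a v k i • E k i) s :=
    DifferentiableOn.fun_sum fun k _ => DifferentiableOn.fun_sum fun i _ => (ha k i).smul_const (E k i)
  exact hsum.congr hC

end Literature.AlgebraicGeometry.ModuliOfAbelianVarieties

end
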